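/-
Copyright (c) 2026 the pub-hodgecm-mathlib formalisation cell (harness21).  Prover seat hodgecm-mathlib-LH4-p12 (g4), Track A «(D-RAM) FOUR-FRAME», unit U2H, the census leaf
(ρ2b′-X) `stub_U2H_fixedPointCensus_typeTwo_unit0` — RHO2BX-ORDER v1 (payer LH4-p14 (g3)) organ O-Cone: the GLUE-NORM TRANSPORT (T2b's `r` ↦ the DEFS leaf's `glueUnit`).  2026-09-04.
-/
import Summits.HodgeConjecture.HodgeConjecture.Theorems.F0P3cDyRamConeLevelTransportOut   -- ★ p857341 (K1)–(K4), (C′≤), (L←); brings ★ (C)(D1–D4), ★ (A)(B)(C′), ★ (W), ★ DEFS leaf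
import HarnessLib

/-!
# Crux `H413`, line LH4 «(D-RAM) FOUR-FRAME», leaf (ρ2b′-X) — organ O-Cone, the GLUE-NORM TRANSPORT: under the line model, T2b's norm datum
# `r = −⟨w₀,w₀⟩·ϖ^bσ(ϖ^b)∕h_mid` of the canonical dual generator `w₀ = φ⁻¹(Y⁻¹x₀)` is `jE`-mapped to the DEFS leaf's `glueUnit ρ Θ α c h (jE ϖ) (jE h_mid) x₀ b`

Cell `hodgecm-mathlib` (D-0151), FLOOR 0, crux H413 = `stmt-HodgeConjecture-24833`, unit U2H, leaf (ρ2b′-X) (OPEN-CONFIRMED, T18-55); RHO2BX-ORDER v1 organ **O-Cone** (LH4-p12 (g4)).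
THEOREMS ONLY (no `def`, no instance, no notation, no `sorry`); lane `--supports stmt-HodgeConjecture-24833 --as helper` (count-neutral).  WHY: ★ T2b
`ncard_glueFibre_eq_natCard_normFibre` (p857229) counts the glue fibre over a W-part `(B, b)` by the norm residues `#Sol_{2b}(r)`, `r = −⟨w₀,w₀⟩·(ϖ^b·σ(ϖ^b))∕h_mid` for ANY
dual generator `w₀` with its binders (the fibre itself does not depend on `w₀`); the T5a∕b∕c tables (LH4-p08 ∕ F0P3-p01 ∕ LH4-p06 (g4)) read the norm class through the DEFS
leaf's (R2) `glueUnit ρ Θ α c h ϖE cU x₀ a` ∕ `IsGlueNorm`.  This file closes that seam: (i) `exists_coneData_of_gen` = ★ (L←) `exists_coneData_of_mem_levelSetDep` with the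
generator `x₀` EXPLICIT and the extra output `φ w₀ = Y⁻¹x₀` (`Y = dualGen ρ Θ α (jE ϖ^j) h x₀`) — the CANONICAL dual generator; (ii) `map_pairing_self_eq_of_map_eq`: for that `w₀`,
`jE⟨w₀,w₀⟩ = h·x₀Θx₀∕(Y·ΘY) + ρ(…)`; (iii) `map_glueNorm_eq`: `jE r = glueUnit ρ Θ α c h (jE ϖ) (jE h_mid) x₀ b` (`Θ ∘ jE = jE ∘ σ`).  So O-Sum reads, per `Λ = x₀𝒪_j ∈
levelSetDep(j, b; lam − jE u)`, the fibre count `#Sol_{2b}(r)` of ★ T2b at `jE r = glueUnit(x₀, b)`.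
HONEST LABEL: count-neutral; HC_CM is proved only modulo the 7 printed citations (2 remaining named inputs: hLiu418 = `stmt-HodgeConjecture-24832`, h413 = `stmt-HodgeConjecture-24833`) until
rung 0 closes.

## References
* [Kottwitz1986BaseChangeUnits] R. E. Kottwitz, *Base change for unit elements of Hecke algebras*, Compositio Math. 60 (1986), §1 pp. 240–241.
* [Jacobowitz1962] R. Jacobowitz, *Hermitian forms over local fields*, Amer. J. Math. 84 (1962), §4 (duals, modular components, gluing).
* [BruhatTits1972] F. Bruhat, J. Tits, *Groupes réductifs sur un corps local I*, Publ. Math. IHÉS 41 (1972), §10.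
-/

set_option autoImplicit false

noncomputable section

open scoped Valued WithZero Matrix MatrixGroups
open WithZero
open scoped Classical
open Literature.NumberTheory.Automorphic Literature.NumberTheory.Automorphic.HermitianLattice Literature.NumberTheory.Automorphic.UnitaryLatticeTree
open Literature.NumberTheory.Automorphic.EllipticPlaneAsFieldLine
open Literature.NumberTheory.LocalFields.QuadraticOrder
open Summit.HodgeConjecture.HodgeConjecture.Cruxes.H413.F0P3cDyRamToricCensusDefs

namespace Summit.HodgeConjecture.HodgeConjecture.Cruxes.H413.F0P3cDyRamConeLevelTransport

variable {E M : Type*} [Field E] [Valued E ℤᵐ⁰] [Field M] [Valued M ℤᵐ⁰] {ρ Θ : M →+* M} {α : M}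

/-! ## §1 The self-pairing of the canonical dual generator -/

omit [Valued M ℤᵐ⁰] in
/-- `h·Θ(Y⁻¹x₀)·(Y⁻¹x₀) = h·x₀Θx₀ ∕ (Y·ΘY)`. [cite: Jacobowitz1962, §4] -/
theorem herm_inv_mul_self_eq (Θ : M →+* M) (h Y x₀ : M) : h * Θ (Y⁻¹ * x₀) * (Y⁻¹ * x₀) = h * (x₀ * Θ x₀) / (Y * Θ Y) := by
  rw [map_mul, map_inv₀]; ring

omit [Valued E ℤᵐ⁰] [Valued M ℤᵐ⁰] in
/-- **The self-pairing of the canonical dual generator**: if `φ w₀ = Y⁻¹x₀` then `jE⟨w₀, w₀⟩ = h·x₀Θx₀∕(Y·ΘY) + ρ(h·x₀Θx₀∕(Y·ΘY))`. [cite: Jacobowitz1962, §4] -/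
theorem map_pairing_self_eq_of_map_eq (σ : E →+* E) (H₂ : Matrix (Fin 2) (Fin 2) E) (jE : E →+* M) (φ : (Fin 2 → E) →+ M) {h : M}
    (hform : ∀ x y, jE (pairing σ H₂ x y) = h * Θ (φ x) * φ y + ρ (h * Θ (φ x) * φ y)) {Y x₀ : M} {w₀ : Fin 2 → E} (hw₀ : φ w₀ = Y⁻¹ * x₀) :
    jE (pairing σ H₂ w₀ w₀) = h * (x₀ * Θ x₀) / (Y * Θ Y) + ρ (h * (x₀ * Θ x₀) / (Y * Θ Y)) := by
  rw [hform, hw₀, herm_inv_mul_self_eq]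

omit [Valued E ℤᵐ⁰] [Valued M ℤᵐ⁰] in
/-- **GLUE-NORM TRANSPORT**: for the canonical dual generator (`φ w₀ = Y⁻¹x₀`, `Y = dualGen ρ Θ α c h x₀`) and `Θ ∘ jE = jE ∘ σ`, T2b's norm datum maps to the DEFS leaf's glue
unit: `jE(−⟨w₀,w₀⟩·(ϖ^a·σ(ϖ^a))∕h_mid) = glueUnit ρ Θ α c h (jE ϖ) (jE h_mid) x₀ a`. [cite: Jacobowitz1962, §4] [cite: Kottwitz1986BaseChangeUnits, §1 pp. 240–241] -/
theorem map_glueNorm_eq (σ : E →+* E) (H₂ : Matrix (Fin 2) (Fin 2) E) (jE : E →+* M) (hΘj : ∀ x, Θ (jE x) = jE (σ x)) (φ : (Fin 2 → E) →+ M) {h : M}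
    (hform : ∀ x y, jE (pairing σ H₂ x y) = h * Θ (φ x) * φ y + ρ (h * Θ (φ x) * φ y)) {c x₀ : M} {w₀ : Fin 2 → E}
    (hw₀ : φ w₀ = (dualGen ρ Θ α c h x₀)⁻¹ * x₀) (ϖ hm : E) (a : ℕ) :
    jE (-(pairing σ H₂ w₀ w₀) * (ϖ ^ a * σ (ϖ ^ a)) / hm) = glueUnit ρ Θ α c h (jE ϖ) (jE hm) x₀ a := by
  rw [glueUnit_def, map_div₀, map_mul jE (-(pairing σ H₂ w₀ w₀)) (ϖ ^ a * σ (ϖ ^ a)), map_neg, map_pairing_self_eq_of_map_eq σ H₂ jE φ hform hw₀,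
    map_mul jE (ϖ ^ a) (σ (ϖ ^ a)), map_pow σ ϖ a, map_pow jE ϖ a, map_pow jE (σ ϖ) a, ← hΘj ϖ, mul_pow]
  ring

/-! ## §2 (L←) with the generator explicit and the canonical dual generator exported -/

/-- **(L←) WITH THE CANONICAL DUAL GENERATOR.**  ★ `exists_coneData_of_mem_levelSetDep` with the generator `x₀` of `Λ = x₀·𝒪_j` explicit (integral, primitive, level `b`, depth for
`lam − jE u`) and the extra output `φ w₀ = Y⁻¹x₀`, `Y = dualGen ρ Θ α (jE ϖ^j) h x₀` — so that ★ T2b's norm datum of THIS `w₀` is `glueUnit(x₀, b)` (`map_glueNorm_eq`).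
[cite: Jacobowitz1962, §4] [cite: Kottwitz1986BaseChangeUnits, §1 pp. 240–241] [cite: BruhatTits1972, §10] -/
theorem exists_coneData_of_gen (σ : E →+* E) {ϖ : E} (hϖ0 : ϖ ≠ 0) (hϖ1 : Valued.v ϖ < 1)
    (H₂ : Matrix (Fin 2) (Fin 2) E) (jE : E →+* M)
    (hρρ : ∀ x, ρ (ρ x) = x) (hvρ : ∀ x, Valued.v (ρ x) = Valued.v x) (hα : ρ α ≠ α) (hα1 : Valued.v α ≤ 1)
    (hint : ∀ z : M, Valued.v z ≤ 1 → Valued.v ((z - ρ z) / (α - ρ α)) ≤ 1)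
    (hΘΘ : ∀ x, Θ (Θ x) = x) (hΘρ : ∀ x, Θ (ρ x) = ρ (Θ x)) (hvΘ : ∀ x, Valued.v (Θ x) = Valued.v x)
    (hjv : ∀ c, Valued.v (jE c) ≤ 1 ↔ Valued.v c ≤ 1) (hjfix : ∀ z, ρ z = z ↔ ∃ c, jE c = z)
    (hjpow : ∀ (t : E) (n : ℤ), Valued.v (jE t) = Valued.v (jE ϖ) ^ n ↔ Valued.v t = Valued.v ϖ ^ n)
    (hϖmax : ∀ t : M, ρ t = t → Valued.v t < 1 → Valued.v t ≤ Valued.v (jE ϖ))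
    (φ : (Fin 2 → E) →+ M) (hφs : ∀ (c : E) (x : Fin 2 → E), φ (c • x) = jE c * φ x) (hφi : Function.Injective φ) (hφo : Function.Surjective φ)
    {γ₂ : GL (Fin 2) E} {lam h : M} (hφγ : ∀ x, φ ((γ₂ : Matrix (Fin 2) (Fin 2) E).mulVec x) = lam * φ x) (hlam : Valued.v lam = 1)
    (hΘh : Θ h = h) (hh : h ≠ 0) (hform : ∀ x y, jE (pairing σ H₂ x y) = h * Θ (φ x) * φ y + ρ (h * Θ (φ x) * φ y))
    (u : E) {b : ℕ} (hb : 1 ≤ b) {j : ℕ} {Λ : AddSubgroup M} {x₀ : M} (hx₀ : x₀ ≠ 0)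
    (hΛx : ∀ x, x ∈ Λ ↔ ∃ z, IsOrd ρ α (jE ϖ ^ j) z ∧ x = x₀ * z) (hyO : IsOrd ρ α (jE ϖ ^ j) (dualGen ρ Θ α (jE ϖ ^ j) h x₀))
    (hyprim : ¬ IsOrd ρ α (jE ϖ ^ j) (dualGen ρ Θ α (jE ϖ ^ j) h x₀ / jE ϖ)) (hylev : Valued.v (dualGen ρ Θ α (jE ϖ ^ j) h x₀) = Valued.v (jE ϖ) ^ b)
    (hdepΛ : ∀ b', (∀ x ∈ Λ, Valued.v (h * Θ x * b' + ρ (h * Θ x * b')) ≤ 1) → (lam - jE u) * b' ∈ Λ) (hlamj : IsOrd ρ α (jE ϖ ^ j) lam) :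
    ∃ B : Submodule 𝒪[E] (Fin 2 → E), B.toAddSubgroup.map φ = Λ ∧ (∃ g : GL (Fin 2) E, B = latt (g : Matrix (Fin 2) (Fin 2) E)) ∧ mapGL γ₂ B = B ∧
      ∃ w₀ : Fin 2 → E, φ w₀ = (dualGen ρ Θ α (jE ϖ ^ j) h x₀)⁻¹ * x₀ ∧ (∀ w, w ∈ B ↔ (w ∈ dualLatt σ H₂ B ∧ Valued.v (pairing σ H₂ w₀ w) ≤ 1)) ∧
        (∀ w ∈ dualLatt σ H₂ B, ∃ (t : E) (a : Fin 2 → E), Valued.v t ≤ 1 ∧ a ∈ B ∧ w = t • w₀ + a) ∧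
        Valued.v (pairing σ H₂ w₀ w₀) * Valued.v ϖ ^ (2 * b) = 1 ∧ (γ₂ : Matrix (Fin 2) (Fin 2) E).mulVec w₀ - u • w₀ ∈ B := by
  -- work with the EXPANDED dual generator `Y = h·(x₀Θx₀)·(c(α − ρα))`
  rw [dualGen_def] at hyO hyprim hylev
  set ϖE : M := jE ϖ with hϖE
  set c : M := ϖE ^ j with hcdef
  have hρϖ : ρ ϖE = ϖE := (hjfix ϖE).2 ⟨ϖ, rfl⟩
  have hϖE0 : ϖE ≠ 0 := (map_ne_zero jE).2 hϖ0
  have hϖE1 : Valued.v ϖE < 1 := by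
    refine lt_of_le_of_ne ((hjv ϖ).2 hϖ1.le) fun hle => ?_
    have := (hjpow ϖ 0).1 (by rw [zpow_zero]; exact hle)
    rw [zpow_zero] at this
    exact hϖ1.ne this
  have hc : ρ c = c := by rw [hcdef, map_pow, hρϖ]
  have hc0 : c ≠ 0 := pow_ne_zero j hϖE0
  have hc1 : Valued.v c ≤ 1 := by rw [hcdef, map_pow]; exact pow_le_one₀ zero_le hϖE1.le
  have hd : α - ρ α ≠ 0 := sub_ne_zero.2 (Ne.symm hα)
  have hΘx₀ : Θ x₀ ≠ 0 := (map_ne_zero Θ).2 hx₀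
  have hY0 : h * (x₀ * Θ x₀) * (c * (α - ρ α)) ≠ 0 := mul_ne_zero (mul_ne_zero hh (mul_ne_zero hx₀ hΘx₀)) (mul_ne_zero hc0 hd)
  have hvY0 : Valued.v (h * (x₀ * Θ x₀) * (c * (α - ρ α))) ≠ 0 := (Valuation.ne_zero_iff _).2 hY0
  have hvYpos : 0 < Valued.v (h * (x₀ * Θ x₀) * (c * (α - ρ α))) := zero_lt_iff.2 hvY0
  have hρY0 : ρ (h * (x₀ * Θ x₀) * (c * (α - ρ α))) ≠ 0 := (map_ne_zero ρ).2 hY0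
  -- the coordinates of `Y` and primitivity in coordinates
  obtain ⟨p, q, ⟨hp, hp1⟩, ⟨hq, hq1⟩, hypq⟩ := (exists_fixed_coords_iff_mem_order hρρ hα hα1 hint hc hc0 hc1 _).2 hyO
  have hprim : Valued.v p = 1 ∨ Valued.v q = 1 := by
    by_contra hcon
    push Not at hcon
    apply hyprim
    have hlt : Valued.v p < 1 ∧ Valued.v q < 1 := ⟨lt_of_le_of_ne hp1 hcon.1, lt_of_le_of_ne hq1 hcon.2⟩
    have := (div_mem_order_iff_coords_lt_one hρρ hα hα1 hint hc hc0 hc1 hρϖ hϖE0 hϖE1 hϖmax hp hq).2 hlt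
    rw [← hypq] at this
    exact this
  -- `|Y| < 1` (level `b ≥ 1`), `|cα| ≤ 1`, exact `ρ`-depth
  have hylt : Valued.v (h * (x₀ * Θ x₀) * (c * (α - ρ α))) < 1 := by
    rw [hylev]
    calc Valued.v ϖE ^ b ≤ Valued.v ϖE ^ 1 := pow_le_pow_right_of_le_one' hϖE1.le hb
      _ = Valued.v ϖE := pow_one _
      _ < 1 := hϖE1
  have hcα : Valued.v (c * α) ≤ 1 := by rw [map_mul]; exact mul_le_one' hc1 hα1
  have hqu : Valued.v q = 1 := by
    rcases hprim with hpu | hqu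
    · by_contra hqu
      have hqlt : Valued.v q < 1 := lt_of_le_of_ne hq1 hqu
      have hsmall : Valued.v (q * (c * α)) < 1 := by
        rw [map_mul]
        calc Valued.v q * Valued.v (c * α) ≤ Valued.v q * 1 := mul_le_mul' le_rfl hcα
          _ = Valued.v q := mul_one _
          _ < 1 := hqlt
      have hval : Valued.v (p + q * (c * α)) = 1 := by
        rw [Valuation.map_add_of_distinct_val _ (by rw [hpu]; exact hsmall.ne'), hpu, max_eq_left hsmall.le]
      rw [← hypq] at hval
      exact absurd hval hylt.ne
    · exact hqu
  have hdepth : Valued.v (h * (x₀ * Θ x₀) * (c * (α - ρ α)) - ρ (h * (x₀ * Θ x₀) * (c * (α - ρ α)))) = Valued.v (c * (α - ρ α)) := by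
    rw [hypq]; exact v_sub_map_eq_of_coord_unit hc hp hq hqu
  -- the lattice `B` and its `γ₂`-stability
  obtain ⟨g, hg⟩ := exists_latt_map_eq_of_order jE hρρ hα hα1 hint hjv hjfix φ hφs hφo hx₀ hc hc0 hc1 hΛx
  have hstab : ∀ x ∈ Λ, lam * x ∈ Λ := (forall_mul_mem_iff_of_eq_mul_order hvρ hx₀ hΛx lam).2 hlamj
  refine ⟨latt (g : Matrix (Fin 2) (Fin 2) E), hg, ⟨g, rfl⟩, ?_, ?_⟩
  · exact (mapGL_eq_iff_forall_mul_mem jE hρρ hvρ hα hα1 hint hjv hjfix φ hφs hφi hφγ hlam g).2 (by rw [hg]; exact hstab)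
  -- the dual generator `w₀ = φ⁻¹(Y⁻¹x₀)`
  obtain ⟨w₀, hw₀⟩ := hφo ((h * (x₀ * Θ x₀) * (c * (α - ρ α)))⁻¹ * x₀)
  have hdual : ∀ w, w ∈ dualLatt σ H₂ (latt (g : Matrix (Fin 2) (Fin 2) E)) ↔ ∀ a ∈ Λ, Valued.v (h * Θ a * φ w + ρ (h * Θ a * φ w)) ≤ 1 := by
    intro w; rw [mem_dualLatt_iff_forall_v_herm_le_one σ H₂ jE ρ Θ h hjv φ hform, hg]
  have hintΛ : ∀ x ∈ Λ, ∀ x' ∈ Λ, Valued.v (h * Θ x * x' + ρ (h * Θ x * x')) ≤ 1 :=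
    (forall_mem_forall_mem_v_herm_le_one_iff hρρ hvρ hα hα1 hint hΘΘ hΘρ hvΘ hc hc0 hc1 h hΛx).2 hyO
  -- `⟨w₀, φ⁻¹(x₀z)⟩` reads the `ρ`-clause
  have hpairM : ∀ z, Valued.v (h * Θ (φ w₀) * (x₀ * z) + ρ (h * Θ (φ w₀) * (x₀ * z))) ≤ 1 ↔ Valued.v (z - ρ z) ≤ Valued.v (c * (α - ρ α)) := by
    intro z; rw [hw₀]; exact v_herm_dualGen_inv_mul_le_one_iff hρρ hα hΘΘ hΘρ hvΘ hc hc0 hΘh hh hx₀ z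
  -- the self-pairing of `w₀`: `|⟨w₀,w₀⟩|·|Y|² = 1`
  have hmain : Valued.v (h * Θ (φ w₀) * φ w₀ + ρ (h * Θ (φ w₀) * φ w₀)) * Valued.v (h * (x₀ * Θ x₀) * (c * (α - ρ α))) ^ 2 = 1 := by
    rw [hw₀]; exact v_herm_dualGen_inv_mul_sq_eq_one_of_le hρρ hvρ hα hΘΘ hΘρ hvΘ hc hc0 hΘh hh hx₀ hp hq hq1 hprim hypq hcα hylt
  have hww : Valued.v (h * Θ (φ w₀) * φ w₀ + ρ (h * Θ (φ w₀) * φ w₀)) = (Valued.v (h * (x₀ * Θ x₀) * (c * (α - ρ α))) ^ 2)⁻¹ :=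
    eq_inv_of_mul_eq_one_left hmain
  -- the dual of `Λ` is `Λ + 𝒪'·Y⁻¹x₀` (★ (A))
  have hA := fun m => forall_mem_herm_iff_exists_add_fixed_mul hρρ hvρ hα hα1 hint hΘΘ hΘρ hvΘ hc hc0 hc1 hh hx₀ hΛx hp hp1 hq hq1 hprim hypq m
  refine ⟨w₀, ?_, ?_, ?_, ?_, ?_⟩
  · rw [dualGen_def]; exact hw₀
  · -- (G1)
    intro w
    constructor
    · intro hwB
      have hφw : φ w ∈ Λ := by rw [← hg]; exact AddSubgroup.mem_map.2 ⟨w, hwB, rfl⟩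
      obtain ⟨z, hz, hwz⟩ := (hΛx _).1 hφw
      refine ⟨(hdual w).2 fun a ha => hintΛ a ha _ hφw, ?_⟩
      rw [← hjv, hform, hwz]; exact (hpairM z).2 hz.2
    · rintro ⟨hwd, hw₀w⟩
      obtain ⟨a, t, ha, ⟨ht, ht1⟩, hφw⟩ := (hA (φ w)).1 ((hdual w).1 hwd)
      obtain ⟨za, hza, rfl⟩ := (hΛx a).1 ha
      -- `|t·⟨w₀,w₀⟩| ≤ 1`
      have htot : Valued.v (h * Θ (φ w₀) * φ w + ρ (h * Θ (φ w₀) * φ w)) ≤ 1 := by rw [← hform, hjv]; exact hw₀w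
      have h1 : Valued.v (h * Θ (φ w₀) * (x₀ * za) + ρ (h * Θ (φ w₀) * (x₀ * za))) ≤ 1 := (hpairM za).2 hza.2
      have hdiff : t * (h * Θ (φ w₀) * φ w₀ + ρ (h * Θ (φ w₀) * φ w₀)) =
          (h * Θ (φ w₀) * φ w + ρ (h * Θ (φ w₀) * φ w)) - (h * Θ (φ w₀) * (x₀ * za) + ρ (h * Θ (φ w₀) * (x₀ * za))) := by
        rw [← herm_fixed_mul_eq ht, hφw, hw₀, mul_add, map_add]; ring
      have hterm : Valued.v t * Valued.v (h * Θ (φ w₀) * φ w₀ + ρ (h * Θ (φ w₀) * φ w₀)) ≤ 1 := by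
        rw [← Valuation.map_mul, hdiff]; exact (Valuation.map_sub _ _ _).trans (max_le htot h1)
      have ht2 : Valued.v t ≤ Valued.v (h * (x₀ * Θ x₀) * (c * (α - ρ α))) ^ 2 := by
        rw [hww, ← div_eq_mul_inv, div_le_one₀ (pow_pos hvYpos 2)] at hterm; exact hterm
      -- `t∕Y ∈ 𝒪_c`
      have hty : IsOrd ρ α c (t / (h * (x₀ * Θ x₀) * (c * (α - ρ α)))) := by
        refine ⟨?_, ?_⟩
        · rw [map_div₀, div_le_one₀ hvYpos]
          calc Valued.v t ≤ Valued.v (h * (x₀ * Θ x₀) * (c * (α - ρ α))) ^ 2 := ht2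
            _ ≤ Valued.v (h * (x₀ * Θ x₀) * (c * (α - ρ α))) := by rw [sq]; exact mul_le_of_le_one_left' hylt.le
        · have hrew : t / (h * (x₀ * Θ x₀) * (c * (α - ρ α))) - ρ (t / (h * (x₀ * Θ x₀) * (c * (α - ρ α)))) =
              t * (ρ (h * (x₀ * Θ x₀) * (c * (α - ρ α))) - h * (x₀ * Θ x₀) * (c * (α - ρ α))) /
                ((h * (x₀ * Θ x₀) * (c * (α - ρ α))) * ρ (h * (x₀ * Θ x₀) * (c * (α - ρ α)))) := by
            rw [map_div₀, ht, div_sub_div _ _ hY0 hρY0]; ring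
          rw [hrew, map_div₀, Valuation.map_mul, Valuation.map_mul, hvρ, Valuation.map_sub_swap, hdepth,
            div_le_iff₀ (mul_pos hvYpos hvYpos)]
          calc Valued.v t * Valued.v (c * (α - ρ α)) ≤ Valued.v (h * (x₀ * Θ x₀) * (c * (α - ρ α))) ^ 2 * Valued.v (c * (α - ρ α)) :=
                mul_le_mul' ht2 le_rfl
            _ = Valued.v (c * (α - ρ α)) * (Valued.v (h * (x₀ * Θ x₀) * (c * (α - ρ α))) * Valued.v (h * (x₀ * Θ x₀) * (c * (α - ρ α)))) := by
                rw [sq]; exact mul_comm _ _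
      have hφwΛ : φ w ∈ Λ := by
        rw [hφw]
        refine Λ.add_mem ((hΛx _).2 ⟨za, hza, rfl⟩) ((hΛx _).2 ⟨t / (h * (x₀ * Θ x₀) * (c * (α - ρ α))), hty, ?_⟩)
        rw [div_eq_mul_inv]; ring
      rw [← hg] at hφwΛ
      obtain ⟨w', hw', hww'⟩ := AddSubgroup.mem_map.1 hφwΛ
      rw [← hφi hww']; exact hw'
  · -- generation `B^♯ = B + 𝒪·w₀`
    intro w hwd
    obtain ⟨a, t, ha, ⟨ht, ht1⟩, hφw⟩ := (hA (φ w)).1 ((hdual w).1 hwd)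
    obtain ⟨t', rfl⟩ := (hjfix t).1 ht
    have haB : a ∈ (latt (g : Matrix (Fin 2) (Fin 2) E)).toAddSubgroup.map φ := by rw [hg]; exact ha
    obtain ⟨a', ha', rfl⟩ := AddSubgroup.mem_map.1 haB
    refine ⟨t', a', (hjv t').1 ht1, ha', hφi ?_⟩
    rw [map_add, hφs, hw₀, hφw, add_comm]
  · -- `|⟨w₀,w₀⟩|·|ϖ|^{2b} = 1`
    have hvy2 : Valued.v (h * (x₀ * Θ x₀) * (c * (α - ρ α))) ^ 2 = Valued.v ϖE ^ (2 * b) := by rw [hylev, ← pow_mul, mul_comm]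
    have hval : Valued.v (jE (pairing σ H₂ w₀ w₀)) = Valued.v (jE ϖ) ^ (-((2 * b : ℕ) : ℤ)) := by
      rw [hform, hww, hvy2, ← hϖE, zpow_neg, zpow_natCast]
    have hval' := (hjpow _ _).1 hval
    rw [hval', zpow_neg, zpow_natCast, inv_mul_cancel₀ (pow_ne_zero _ ((Valuation.ne_zero_iff _).2 hϖ0))]
  · -- the tube criterion `γ₂w₀ − u•w₀ ∈ B`
    have hdepO : IsOrd ρ α c ((lam - jE u) / (h * (x₀ * Θ x₀) * (c * (α - ρ α)))) := by
      have := (forall_herm_mul_mem_iff_isOrd_div hρρ hvρ hα hα1 hint hΘΘ hΘρ hvΘ hc hc0 hc1 hh hx₀ hΛx (lam - jE u)).1 hdepΛ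
      rwa [dualGen_def] at this
    have hmem : (lam - jE u) * ((h * (x₀ * Θ x₀) * (c * (α - ρ α)))⁻¹ * x₀) ∈ Λ :=
      (hΛx _).2 ⟨(lam - jE u) / (h * (x₀ * Θ x₀) * (c * (α - ρ α))), hdepO, by rw [div_eq_mul_inv]; ring⟩
    rw [← hg] at hmem
    obtain ⟨b', hb', hbb'⟩ := AddSubgroup.mem_map.1 hmem
    have heq : (γ₂ : Matrix (Fin 2) (Fin 2) E).mulVec w₀ - u • w₀ = b' := by
      apply hφi
      rw [map_sub, hφγ, hφs, hw₀, hbb']; ring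
    rw [heq]; exact hb'

end Summit.HodgeConjecture.HodgeConjecture.Cruxes.H413.F0P3cDyRamConeLevelTransport

end
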